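import Literature.MathematicalPhysics.QuantumFieldTheory.Balaban1983to89.T4BlockwiseCombGauge
import Literature.MathematicalPhysics.QuantumFieldTheory.Balaban1983to89.T4BlockTransport

/-!
# `Balaban1983to89.T4MultilevelCombGauge` — ROOT FREEDOM of the block-wise relative comb gauge, and the MULTILEVEL
# (k-step) relative comb hierarchy: fine relative deviation ≤ Σ_j crossConst(L_j)·(curvatures of level j) + top deviation

CITATION HEADER (lean-in-tree rule 2026-08-18).  Kernel certificate, on the CONCRETE `ℤ^d` carriers of `T4RelativeComb`
(`Cfg d R = (ℤ^d → Fin d → Rˣ)`, `R` any normed ring), of the ITERATION of this lineage's lattice bound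
`T4BlockwiseCombGauge.lattice_bound_coarse` (audit cell `pub-balaban`, T4-DAG v19 carved rows `T4-O3.E-NE1′-OG1′-RESID°` /
`-LATTICE*`; self-row `T4-O3.E-NE1′-OG1′-MULTILEVEL*` of unit `b2b-balaban-pv04` gen 15).
§1 GAUGE ALGEBRA: composition of gauge actions (`gaugeAct_mul`) and — from the GAUGE COVARIANCE OF TREE HOLONOMIES
`T4BlockTransport.hol_gaugeAct` (`(U^H)(Γ_{z,z+k}) = H(z)·U(Γ_{z,z+k})·H(z+k)⁻¹`, BY NAME) — of the straight coarse
transports (`coarse_gaugeAct`).  §2 THE COARSE LATTICE RE-INDEXED: `cornerOf L y' = L·y'`, `blockIndex L x = ⌊x/L⌋`, the lift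
`liftGauge L h = h ∘ blockIndex` of a gauge `h` on the coarse lattice to a BLOCK-CONSTANT gauge, and the coarse pair as a
configuration on `ℤ^d`, `scaled L U y' ν = U(Γ_{Ly', Ly'+Le_ν})` (`scaled_gaugeAct`: coarse-graining is gauge covariant,
`scaled L (U^G) = (scaled L U)^{G∘cornerOf}`).  §3 ROOT FREEDOM: for ANY gauge `h` on the coarse lattice the ROOTED
block-wise relative comb gauge `rooted L h U₀ U₁ = blockComb L U₀ (U₁^{H})·H`, `H = liftGauge L h`, (a) puts `(U₀, U₁^g)`
in relative axial gauge in EVERY block (`treeRel_rooted`), (b) takes the value `h(y')` at the corner `Ly'`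
(`rooted_cornerOf`) and on the block is `g(y+k) = U₀(Γ_{y,y+k})⁻¹·h(y')·U₁(Γ_{y,y+k})` (`rooted_site`), (c) is the ONLY
gauge with (a) and given corner values (`gauge_site_of_treeRel`, `eq_rooted_of_treeRel`: UNIQUENESS GIVEN ROOT VALUES),
(d) its coarse pair is the coarse pair of `(U₀, U₁)` in the gauge `h` (`scaled_gaugeAct_rooted`), and (e) THE ROOTED
LATTICE BOUND `lattice_bound_rooted`: every bond of `ℤ^d` has `‖(U₁^g)(b)·U₀(b)⁻¹ − 1‖ ≤ crossConst d L·(q₁ + q₀) + X`,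
`X` = sup of the relative deviation of the coarse pair `(scaled L U₀, (scaled L U₁)^h)` IN THE COARSE GAUGE `h` — the
free number of `T4BlockwiseCombGauge` is now at the disposal of the next level.  §4 SCALE COMPOSITION: straight
transports concatenate (`hol_line_append`), `scaled L' (scaled L U) = scaled (L·L') U` (`scaled_scaled`), `scaled 1 U = U`.
§5 TWO LEVELS: choose `h :=` the block-wise comb gauge of the coarse pair at scale `L'` (`two_level_bound`:
`≤ crossConst d L·(q₁+q₀) + crossConst d L'·(Q₁+Q₀) + X⁽ᴸᴸ'⁾`).  §6 k LEVELS: the recursive gauge `multiComb [L₁,…,L_k] hTop`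
(rooted at each level in the next level's gauge, top gauge `hTop` free), its root values / coherence
(`multiComb_cons_cornerOf`, `multiComb_top`, `scaled_gaugeAct_multiComb`) and THE MULTILEVEL BOUND `multilevel_bound`:
`‖(U₁^g)(b)·U₀(b)⁻¹ − 1‖ ≤ Σ_j crossConst d L_j·(q₁⁽ʲ⁾ + q₀⁽ʲ⁾) + X` on EVERY bond of `ℤ^d`, with `qᵢ⁽ʲ⁾` the curvature sups of
the level-`j` coarse configurations `scaled (L₁⋯L_j) Uᵢ` (FREE hypotheses) and `X` the top-level relative deviation in the
gauge `hTop`.  §7 THE COARSE CURVATURES DISCHARGED: the dictionary `scaled L U = T4BlockTransport.blockCfg L U`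
(`blockCfg_eq_scaled`, via `segHol = hol` on straight segments) and `T4BlockTransport.norm_plaq_blockCfg_sub_one_le'`
(non-abelian Stokes on the `L × L` rectangle, BY NAME) give `‖plaq (scaled L U) − 1‖ ≤ L²·q`
(`norm_plaq_scaled_sub_one_le`), so `qᵢ⁽ʲ⁾ ≤ (L₁⋯L_j)²·qᵢ` and the GLOBAL form `multilevel_bound_global`:
`≤ Σ_j crossConst d L_{j+1}·(L₁⋯L_j)²·(q₁ + q₀) + X`.  §8 non-vacuity / sanity.

PRINTED STATUS.  NOTHING printed enters any declaration; every declaration is [folklore] and kernel-proved (straight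
transports `coarse` where print has block AVERAGES; explicit sup-norm constants; corner/root values left FREE where print
FIXES them).  CONTEXT ONLY — the printed structure this types the skeleton of is [Balaban1985Averaging] (T. Bałaban,
"Averaging Operations for Lattice Gauge Theories", CMP 98 (1985) 17–51), Sect. C («C. Other Averaging Operations», from
p. 26 on), quoted VERBATIM from the page renders `b2b-balaban-ref1/pages/1985-cmp98-averaging/…-p010-x2.png … -p014-x2.png`
(journal pp. 26–30; PDF page = journal page − 16) read as images by this seat:
(α) gauge covariance of the coarse variable, p. 27: «Let us recall that if we apply a gauge transformation v to a
configuration V, V_b^v = v(b₋)V_b v⁻¹(b₊), b ⊂ Ω′, then (\overline{V^v})_c = v(c₋)V̄_c v⁻¹(c₊), c ⊂ Ω′⁽¹⁾.» (here: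
`coarse_gaugeAct`, `scaled_gaugeAct`, for the straight transport instead of the average; p. 29 (70) is its j-th order
form «Ū^j_b = (\overline{U₁^u U₀})^j_b = u(b₋)(\overline{U₁U₀})^j_b u⁻¹(b₊), b ⊂ Ω⁽ʲ⁾»);  (β) the block-wise axial
gauge relative to `V₀` and ITS ROOT FREEDOM, p. 27 (58)/(60): «(R_{0,y}V′)(Γ_{y,x}) = ∏_{b⊂Γ_{y,x}} R(V₀(Γ_{y,b₋}))V′_b = 1,
x ∈ B(y), x ≠ y. (58)» … «The gauge conditions (58) written in terms of the configurations V₁ and v have the form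
(R_{0,y}V′)(Γ_{y,x}) = v(y)(R_{0,y}V₁)(Γ_{y,x})(R_{0,y}v)⁻¹(x) = 1, (R_{0,y}v)(x) = R(V₀(Γ_{y,x}))v(x), and they imply
(R_{0,y}v)(x) = v(y)(R_{0,y}V₁)(Γ_{y,x}), x ∈ B(y), x ≠ y, y ∈ Ω′⁽¹⁾. (60)  To determine the configuration v uniquely, we
will impose on it an additional condition at each block.» (here: `rooted_site` / `gauge_site_of_treeRel` is the (60)-type
formula `g(x) = U₀(Γ_{y,x})⁻¹·g(y)·U₁(Γ_{y,x})`, `eq_rooted_of_treeRel` the uniqueness given `g(y)`; the «additional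
condition» — p. 28 (61) «(\overline{R₀v})(y) = … = 1», solved by (62), «Thus the gauge transformation v is determined
uniquely by the gauge conditions (58) and conditions (61). It is a function of the gauge transformed configuration V₁.» —
is NOT typed: the root values stay free);  (γ) the k-level hierarchy,
p. 29: «The same reasoning can be applied to a higher order average Ū^k, where U = U′U₀, U₀ is a fixed configuration and
U′ satisfies a sequence of axial gauge conditions in blocks of lattices Ω, Ω⁽¹⁾, …, Ω⁽ᵏ⁻¹⁾. More precisely, we describe
these conditions in the following way. For blocks of the lattice Ω, we assume (R_{0,y}U′)(Γ_{y,x}) = 1, x ∈ B(y), x ≠ y,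
y ∈ Ω⁽¹⁾, (64) where R₀ is defined by the configuration U₀. Next defining (Ũ′)_c = (\overline{U′U₀})_c(Ū₀)_c⁻¹, (65) we
assume (R̄_{0,z}Ũ′)(Γ_{z,y}) = 1, y ∈ B(z), y ≠ z, z ∈ Ω⁽²⁾, (66) and R̄₀ is defined by Ū₀. If an average Ũ′^j is defined
on the lattice Ω⁽ʲ⁾, j < k, then we assume (R̄^j_{0,y}Ũ′^j)(Γ_{y,x}) = 1, x ∈ B(y), x ≠ y, y ∈ Ω⁽ʲ⁺¹⁾, (67) and we define
Ũ′^{j+1}_c = (\overline{Ũ′^jŪ₀^j})_c(\overline{Ū₀^j})_c⁻¹. (68)» and p. 29 (73)/(74) «Solving these equations, we get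
(R_{0,x₁}u)(x) = u(x₁)(R_{0,x₁}U₁)(Γ_{x₁,x}) for x ∈ B(x₁), x₁ ∈ Ω⁽¹⁾, (73)  (R̄_{0,x₂}u)(x₁) = u(x₂)(R̄_{0,x₂}Ũ₁)(Γ_{x₂,x₁})
for x₁ ∈ B(x₂), x₂ ∈ Ω⁽²⁾, (74)» (here: `multiComb`, `scaled_gaugeAct_rooted` = the (65)/(68)-type coherence "the coarse
pair of the gauge-fixed fine pair is the next level's pair", `multiComb_cons_cornerOf` = the (73)/(74)-type nesting of
root values);  (δ) uniqueness given the top values, p. 30: «Taking (77) for j = k − 1, we may determine the gauge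
transformation u uniquely, given values u(y) at points y of the lattice Ω⁽ᵏ⁾. We calculate these values from additional
conditions, as in (61) and (62).» and «The additional conditions are (\overline{R₀u}^k)(y) = 1, y ∈ Ω⁽ᵏ⁾. (81)» (here: the
top gauge `hTop` of `multiComb` is a FREE input; (81) is NOT typed);  (ε) the `L²`-per-level law of §7, p. 26: «Each
averaging operation rescales a bound on plaquette variables approximately by the factor L², hence k operations by the
factor L^{2k}.» (printed for the AVERAGES, with a correction: Proposition 1 (51) «|V̄(∂p′) − 1| < L²α₀ + C₀(L²α₀)².»; here
the exact `L²·q` for straight transports is `T4BlockTransport`'s non-abelian Stokes, BY NAME).  No cited-fact binder, no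
summit-side statement.  The cite tags below are the imported files'.

HONEST SCOPE.  (i) Sup norms, unitary-like pairs and unitary-like gauges only (`T4RelativeLadder.UnitaryLike`); the
factorised/complexified version of `T4BlockwiseCombGauge` §4 is NOT iterated here.  (ii) The coarse variables are the
STRAIGHT transports `U(Γ_{y,y+Le_ν})` (`coarse`/`scaled`), not Bałaban's block averages `V̄`, `Ū^j`; the root values (print:
fixed by the conditions (61)/(81)) are free inputs `h`, `hTop` — so the bounds carry the top-level relative
deviation `X` (in the top gauge) as a HYPOTHESIS, and nothing here bounds it.  (iii) The per-level curvature sups are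
hypotheses; §7 discharges them only by the crude count `(L₁⋯L_j)²·q` (no rescaling to the unit lattice of level `j` is
performed — all lattices here are `ℤ^d` re-indexed, `cornerOf`; `T4BlockTransport.blockCfg` is the same object, §7).
(iv) `L_j ≥ 1` only.  (v) NO statement about Bałaban's averaging operations, Hölder norms, windows or renormalization
transformations.  Value = kernel bookkeeping (gauge algebra + Euclidean division + the lattice bound and the lattice
Stokes theorem BY NAME, iterated along a list of scales); NOT summit progress.
-/

namespace Literature.MathematicalPhysics.QuantumFieldTheory.Balaban1983to89.T4MultilevelCombGauge

open Finset
open B8Lemma1Lattice (e site site_add_single site_site InBlock inBlock_site_iff exists_offset_of_inBlock)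
open T4RelativeLadder (UnitaryLike norm_conj_sub_one_eq)
open T4RelativeComb (Cfg gaugeAct plaq plaq_gaugeAct unitaryLike_gaugeAct IsTree isTree_zero low pred' pred'_le
  pred'_add_single isTree_pred' sum_eq_sum_pred'_succ hol hol_zero hol_succ relGauge combGauge combGauge_site
  combGauge_corner)
open T4RelativeCombCrossing (pert TreeRel crossConst)
open T4BlockwiseCombGauge (corner IsCorner isCorner_corner inBlock_corner corner_eq_of_inBlock blockComb
  unitaryLike_blockComb blockComb_of_inBlock treeRel_blockComb hol_line_succ coarse unitaryLike_coarse inBlock_self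
  lattice_bound_coarse)
open T4BlockTransport (hol_gaugeAct segHol segHol_zero segHol_succ blockCfg norm_plaq_blockCfg_sub_one_le')

variable {R : Type*} [NormedRing R] {d : ℕ}

/-- [folklore] Sites of `ℤ^d` (the carrier of `T4RelativeComb.Site d`, definitionally). -/
abbrev Site (d : ℕ) : Type := Fin d → ℤ

example (d : ℕ) : Site d = T4RelativeComb.Site d := rfl

/-! ## §1  Gauge algebra: composition of gauge actions, gauge covariance of tree holonomies -/

/-- [folklore] The corner is the site at offset `0`. -/
theorem site_zero (z : Site d) : site z (0 : Fin d → ℕ) = z := by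
  funext κ; simp [site]

/-- [folklore] COMPOSITION OF GAUGE ACTIONS: `U^{g₁·g₂} = (U^{g₂})^{g₁}` (pointwise product of gauges). -/
theorem gaugeAct_mul (g₁ g₂ : Site d → Rˣ) (U : Cfg d R) : gaugeAct (g₁ * g₂) U = gaugeAct g₁ (gaugeAct g₂ U) := by
  funext x ν
  simp only [gaugeAct, Pi.mul_apply, mul_inv_rev, mul_assoc]

/- GAUGE COVARIANCE OF THE TREE HOLONOMY `(U^H)(Γ_{z,z+k}) = H(z)·U(Γ_{z,z+k})·H(z+k)⁻¹` is the tree theorem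
`T4BlockTransport.hol_gaugeAct`, used BY NAME below. -/

/-- [folklore] GAUGE COVARIANCE OF THE COARSE TRANSPORT (from `T4BlockTransport.hol_gaugeAct`): `(U^H)⁽ᴸ⁾⟨y,ν⟩ = H(y)·U⁽ᴸ⁾⟨y,ν⟩·H(y+Le_ν)⁻¹` (CONTEXT:
[Balaban1985Averaging] p. 27 «(\overline{V^v})_c = v(c₋)V̄_c v⁻¹(c₊)» is this law for the AVERAGE; here the straight
transport). -/
theorem coarse_gaugeAct (L : ℕ) (H : Site d → Rˣ) (U : Cfg d R) (y : Site d) (ν : Fin d) :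
    coarse L (gaugeAct H U) y ν = H y * coarse L U y ν * (H (site y (Pi.single ν L)))⁻¹ :=
  hol_gaugeAct H U y _

/-- [folklore] Curvature sups are gauge invariant for unitary-like gauges (conjugation isometry). -/
theorem plaq_bound_gaugeAct [NormOneClass R] {H : Site d → Rˣ} {U : Cfg d R} {q : ℝ} (hH : ∀ x, UnitaryLike (H x))
    (hq : ∀ x ρ κ, ρ ≠ κ → ‖(plaq U x ρ κ : R) - 1‖ ≤ q) :
    ∀ x ρ κ, ρ ≠ κ → ‖(plaq (gaugeAct H U) x ρ κ : R) - 1‖ ≤ q := by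
  intro x ρ κ hρκ
  rw [plaq_gaugeAct, Units.val_mul, Units.val_mul, norm_conj_sub_one_eq (hH x)]
  exact hq x ρ κ hρκ

/-! ## §2  The coarse lattice re-indexed by `ℤ^d`: corners `L·y'`, block indices, block-constant lifts, `scaled` -/

/-- [folklore] The BLOCK INDEX of a site: `⌊x_i / L⌋` coordinatewise (Euclidean division), a point of the coarse lattice
`ℤ^d ≅ Lℤ^d`. -/
def blockIndex (L : ℕ) (x : Site d) : Site d := fun i => x i / (L : ℤ)

/-- [folklore] The CORNER of the block with index `y'`: `L·y' ∈ Lℤ^d`. -/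
def cornerOf (L : ℕ) (y' : Site d) : Site d := fun i => (L : ℤ) * y' i

/-- [folklore] `corner L x = L·⌊x/L⌋` is the corner of the block index (definitionally). -/
theorem corner_eq (L : ℕ) (x : Site d) : corner L x = cornerOf L (blockIndex L x) := rfl

/-- [folklore] `L·y'` is a corner. -/
theorem isCorner_cornerOf (L : ℕ) (y' : Site d) : IsCorner L (cornerOf L y') := fun i => ⟨y' i, rfl⟩

/-- [folklore] The block index of the corner `L·y'` is `y'` (`L ≥ 1`). -/
theorem blockIndex_cornerOf {L : ℕ} (hL : 1 ≤ L) (y' : Site d) : blockIndex L (cornerOf L y') = y' := by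
  funext i
  have hL0 : (L : ℤ) ≠ 0 := by exact_mod_cast (show L ≠ 0 by omega)
  exact Int.mul_ediv_cancel_left _ hL0

/-- [folklore] A corner is the corner of its block index. -/
theorem cornerOf_blockIndex {L : ℕ} {y : Site d} (hy : IsCorner L y) : cornerOf L (blockIndex L y) = y := by
  funext i
  obtain ⟨m, hm⟩ := hy i
  show (L : ℤ) * (y i / (L : ℤ)) = y i
  rw [hm]
  rcases eq_or_ne (L : ℤ) 0 with h0 | h0
  · simp [h0]
  · rw [Int.mul_ediv_cancel_left _ h0]

/-- [folklore] All points of the block `B(y)`, `y ∈ Lℤ^d`, have the block index of `y`. -/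
theorem blockIndex_of_inBlock {L : ℕ} (hL : 1 ≤ L) {y x : Site d} (hy : IsCorner L y) (hx : InBlock L y x) :
    blockIndex L x = blockIndex L y := by
  have h1 := corner_eq_of_inBlock hL hy hx
  have h2 := corner_eq_of_inBlock hL hy (inBlock_self hL y)
  have hL0 : (L : ℤ) ≠ 0 := by exact_mod_cast (show L ≠ 0 by omega)
  funext i
  have e1 := congrFun h1 i
  have e2 := congrFun h2 i
  simp only [corner] at e1 e2
  exact mul_left_cancel₀ hL0 (e1.trans e2.symm)

/-- [folklore] Moving `n` coarse steps from the corner `L·y'` is moving `L·n` fine steps: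
`L·y' + (L·n)e_ν = L·(y' + n e_ν)`. -/
theorem site_cornerOf_single (L : ℕ) (y' : Site d) (ν : Fin d) (n : ℕ) :
    site (cornerOf L y') (Pi.single ν (L * n)) = cornerOf L (site y' (Pi.single ν n)) := by
  funext i
  by_cases h : i = ν
  · subst h; simp [site, cornerOf, mul_add]
  · simp [site, cornerOf, h]

/-- [folklore] In particular `L·y' + Le_ν = L·(y' + e_ν)`: the far end of the coarse bond is the next corner. -/
theorem site_cornerOf (L : ℕ) (y' : Site d) (ν : Fin d) :
    site (cornerOf L y') (Pi.single ν L) = cornerOf L (y' + e ν) := by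
  funext i
  by_cases h : i = ν
  · subst h; simp [site, cornerOf, e, mul_add]
  · simp [site, cornerOf, e, h]

/-- [folklore] Corners of corners: `L·(L'·y) = (L·L')·y`. -/
theorem cornerOf_cornerOf (L L' : ℕ) (y : Site d) : cornerOf L (cornerOf L' y) = cornerOf (L * L') y := by
  funext i; simp [cornerOf, mul_assoc]

/-- [folklore] THE BLOCK-CONSTANT LIFT of a gauge `h` on the coarse lattice: `H(x) = h(⌊x/L⌋)`. -/
def liftGauge (L : ℕ) (h : Site d → Rˣ) : Site d → Rˣ := fun x => h (blockIndex L x)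

/-- [folklore] At the corner `L·y'` the lift takes the value `h(y')`. -/
theorem liftGauge_cornerOf {L : ℕ} (hL : 1 ≤ L) (h : Site d → Rˣ) (y' : Site d) :
    liftGauge L h (cornerOf L y') = h y' := by
  simp only [liftGauge, blockIndex_cornerOf hL]

/-- [folklore] The lift is constant on blocks. -/
theorem liftGauge_of_inBlock {L : ℕ} (hL : 1 ≤ L) (h : Site d → Rˣ) {y x : Site d} (hy : IsCorner L y)
    (hx : InBlock L y x) : liftGauge L h x = liftGauge L h y := by
  simp only [liftGauge, blockIndex_of_inBlock hL hy hx]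

/-- [folklore] The lift of a unitary-like gauge is unitary-like. -/
theorem unitaryLike_liftGauge {h : Site d → Rˣ} (hh : ∀ y', UnitaryLike (h y')) (L : ℕ) :
    ∀ x, UnitaryLike (liftGauge L h x) := fun _ => hh _

/-- [folklore] THE COARSE PAIR AS A CONFIGURATION ON `ℤ^d`: `scaled L U ⟨y', ν⟩ := U⁽ᴸ⁾⟨L·y', ν⟩ = U(Γ_{Ly', Ly'+Le_ν})`, the
straight `L`-step transport on the coarse bond of block index `y'` (the coarse lattice `Lℤ^d` re-indexed by `ℤ^d`, so
that the construction can be ITERATED; CONTEXT: print's coarse variable is the block average). -/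
def scaled (L : ℕ) (U : Cfg d R) : Cfg d R := fun y' ν => coarse L U (cornerOf L y') ν

/-- [folklore] COARSE-GRAINING IS GAUGE COVARIANT: `scaled L (U^G) = (scaled L U)^{G ∘ cornerOf L}` for ANY gauge `G`
(only its corner values matter). -/
theorem scaled_gaugeAct (L : ℕ) (G : Site d → Rˣ) (U : Cfg d R) :
    scaled L (gaugeAct G U) = gaugeAct (fun y' => G (cornerOf L y')) (scaled L U) := by
  funext y' ν
  simp only [scaled, gaugeAct, coarse_gaugeAct, site_cornerOf]

/-- [folklore] In particular for a block-constant lift: `scaled L (U^{liftGauge h}) = (scaled L U)^h`. -/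
theorem scaled_gaugeAct_liftGauge {L : ℕ} (hL : 1 ≤ L) (h : Site d → Rˣ) (U : Cfg d R) :
    scaled L (gaugeAct (liftGauge L h) U) = gaugeAct h (scaled L U) := by
  rw [scaled_gaugeAct]
  congr 1
  funext y'
  exact liftGauge_cornerOf hL h y'

/-- [folklore] The coarse configuration of a unitary-like configuration is unitary-like. -/
theorem unitaryLike_scaled [NormOneClass R] {U : Cfg d R} (hU : ∀ x ν, UnitaryLike (U x ν)) (L : ℕ) :
    ∀ y' ν, UnitaryLike (scaled L U y' ν) := fun y' ν => unitaryLike_coarse hU L (cornerOf L y') ν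

/-! ## §3  ROOT FREEDOM: the rooted block-wise relative comb gauge, uniqueness given root values, the rooted bound -/

/-- [folklore] THE ROOTED BLOCK-WISE RELATIVE COMB GAUGE with root values `h` (a gauge on the coarse lattice):
`g = blockComb L U₀ (U₁^H)·H`, `H = liftGauge L h` — first rotate `U₁` by the block-constant `H`, then comb-gauge the pair
block-wise (CONTEXT: (60) with `v(y)` free). -/
noncomputable def rooted (L : ℕ) (h : Site d → Rˣ) (U₀ U₁ : Cfg d R) : Site d → Rˣ :=
  fun x => blockComb L U₀ (gaugeAct (liftGauge L h) U₁) x * liftGauge L h x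

/-- [folklore] Acting by the rooted gauge = acting by the lift, then by the block-wise comb gauge of the rotated pair. -/
theorem gaugeAct_rooted (L : ℕ) (h : Site d → Rˣ) (U₀ U₁ : Cfg d R) :
    gaugeAct (rooted L h U₀ U₁) U₁ =
      gaugeAct (blockComb L U₀ (gaugeAct (liftGauge L h) U₁)) (gaugeAct (liftGauge L h) U₁) :=
  gaugeAct_mul _ _ U₁

/-- [folklore] The rooted gauge is unitary-like for unitary-like data. -/
theorem unitaryLike_rooted [NormOneClass R] {U₀ U₁ : Cfg d R} {h : Site d → Rˣ} (hU₀ : ∀ x ν, UnitaryLike (U₀ x ν))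
    (hU₁ : ∀ x ν, UnitaryLike (U₁ x ν)) (hh : ∀ y', UnitaryLike (h y')) (L : ℕ) (x : Site d) :
    UnitaryLike (rooted L h U₀ U₁ x) :=
  (unitaryLike_blockComb hU₀ (unitaryLike_gaugeAct (unitaryLike_liftGauge hh L) hU₁) L x).mul (hh _)

/-- [folklore] (a) RELATIVE AXIAL GAUGE IN EVERY BLOCK, FOR ANY ROOT VALUES: `(U₀, U₁^g)` satisfies `TreeRel` on `B(y)`
for every `y ∈ Lℤ^d` (CONTEXT: (58)/(64) «(R_{0,y}U′)(Γ_{y,x}) = 1, x ∈ B(y)»). -/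
theorem treeRel_rooted {L : ℕ} (hL : 1 ≤ L) {y : Site d} (hy : IsCorner L y) (h : Site d → Rˣ) (U₀ U₁ : Cfg d R) :
    TreeRel L y U₀ (gaugeAct (rooted L h U₀ U₁) U₁) := by
  rw [gaugeAct_rooted]
  exact treeRel_blockComb hL hy U₀ _

/-- [folklore] (b) ROOT VALUES: at the corner `L·y'` the rooted gauge IS `h(y')`. -/
theorem rooted_cornerOf {L : ℕ} (hL : 1 ≤ L) (h : Site d → Rˣ) (U₀ U₁ : Cfg d R) (y' : Site d) :
    rooted L h U₀ U₁ (cornerOf L y') = h y' := by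
  simp only [rooted]
  rw [blockComb_of_inBlock hL U₀ _ (isCorner_cornerOf L y') (inBlock_self hL _), combGauge_corner, one_mul,
    liftGauge_cornerOf hL]

/-- [folklore] (b′) THE EXPLICIT FORMULA on the block `B(y)`, `y ∈ Lℤ^d`:
`g(y + k) = U₀(Γ_{y,y+k})⁻¹·h(⌊y/L⌋)·U₁(Γ_{y,y+k})` (CONTEXT: the (60)/(73)-type formula «(R_{0,y}v)(x) = v(y)(R_{0,y}V₁)(Γ_{y,x})»). -/
theorem rooted_site {L : ℕ} (hL : 1 ≤ L) {y : Site d} (hy : IsCorner L y) (h : Site d → Rˣ) (U₀ U₁ : Cfg d R)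
    (k : Fin d → ℕ) (hk : ∀ κ, k κ < L) :
    rooted L h U₀ U₁ (site y k) = (hol U₀ y k)⁻¹ * h (blockIndex L y) * hol U₁ y k := by
  have hx : InBlock L y (site y k) := (inBlock_site_iff L y k).2 hk
  simp only [rooted]
  rw [blockComb_of_inBlock hL U₀ _ hy hx, combGauge_site, relGauge, hol_gaugeAct, liftGauge_of_inBlock hL h hy hx]
  simp only [liftGauge]
  group

/-- [folklore] (c) UNIQUENESS ON A BLOCK: ANY gauge `g` with `(U₀, U₁^g)` in relative axial gauge on `B(y)` is determined
there by its corner value, `g(y + k) = U₀(Γ_{y,y+k})⁻¹·g(y)·U₁(Γ_{y,y+k})` (the tree condition is a first-order recursion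
along the staircase tree). -/
theorem gauge_site_of_treeRel {L : ℕ} {y : Site d} {U₀ U₁ : Cfg d R} {g : Site d → Rˣ}
    (hT : TreeRel L y U₀ (gaugeAct g U₁)) :
    ∀ k : Fin d → ℕ, (∀ κ, k κ < L) → g (site y k) = (hol U₀ y k)⁻¹ * g y * hol U₁ y k := by
  suffices hS : ∀ n (k : Fin d → ℕ), ∑ ρ, k ρ = n → (∀ κ, k κ < L) →
      g (site y k) = (hol U₀ y k)⁻¹ * g y * hol U₁ y k from fun k hk => hS _ k rfl hk
  intro n
  induction n with
  | zero =>
      intro k hk _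
      have hk0 : k = 0 := by
        funext κ; exact (Finset.sum_eq_zero_iff.1 hk) κ (mem_univ κ)
      subst hk0
      rw [hol_zero, hol_zero, site_zero, inv_one, one_mul, mul_one]
  | succ n ih =>
      intro k hk hkL
      obtain ⟨ρ₁, -, hρ₁⟩ : ∃ ρ ∈ (univ : Finset (Fin d)), k ρ ≠ 0 :=
        Finset.exists_ne_zero_of_sum_ne_zero (by omega)
      have h : ∃ ρ, k ρ ≠ 0 := ⟨ρ₁, hρ₁⟩
      have hn : ∑ ρ, pred' k h ρ = n := by have := sum_eq_sum_pred'_succ k h; omega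
      have hpL : ∀ κ, pred' k h κ < L := fun κ => (pred'_le k h κ).trans_lt (hkL κ)
      have hend : pred' k h (low k h) + 1 < L := by
        have h1 := congrFun (pred'_add_single k h) (low k h)
        simp only [Pi.add_apply, Pi.single_eq_same] at h1
        have h2 := hkL (low k h)
        omega
      have step : ∀ V : Cfg d R, hol V y k = hol V y (pred' k h) * V (site y (pred' k h)) (low k h) := fun V => by
        conv_lhs => rw [← pred'_add_single k h]
        exact hol_succ V y (isTree_pred' k h)
      have hsite : site y (pred' k h) + e (low k h) = site y k := by
        rw [← site_add_single, pred'_add_single]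
      have hrel := hT _ _ hpL hend (isTree_pred' k h)
      simp only [gaugeAct] at hrel
      rw [hsite] at hrel
      have e1 : g (site y k) =
          (U₀ (site y (pred' k h)) (low k h))⁻¹ * g (site y (pred' k h)) * U₁ (site y (pred' k h)) (low k h) := by
        rw [← hrel]; group
      rw [e1, ih _ hn hpL, step U₀, step U₁]
      group

/-- [folklore] (c′) **UNIQUENESS GIVEN ROOT VALUES** on all of `ℤ^d`: a gauge `g` putting `(U₀, U₁^g)` in relative axial
gauge in EVERY block `B(y)`, `y ∈ Lℤ^d`, IS the rooted gauge with root values `y' ↦ g(L·y')` (CONTEXT: p. 30 «we may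
determine the gauge transformation u uniquely, given values u(y) at points y of the lattice Ω⁽ᵏ⁾»). -/
theorem eq_rooted_of_treeRel {L : ℕ} (hL : 1 ≤ L) {U₀ U₁ : Cfg d R} {g : Site d → Rˣ}
    (hg : ∀ y, IsCorner L y → TreeRel L y U₀ (gaugeAct g U₁)) :
    g = rooted L (fun y' => g (cornerOf L y')) U₀ U₁ := by
  funext x
  have hy := isCorner_corner L x
  have hc : cornerOf L (blockIndex L (corner L x)) = corner L x := cornerOf_blockIndex hy
  obtain ⟨k, hk, hxk⟩ := exists_offset_of_inBlock (inBlock_corner hL x)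
  rw [← hxk, gauge_site_of_treeRel (hg _ hy) k hk, rooted_site hL hy _ U₀ U₁ k hk, hc]

/-- [folklore] (d) COHERENCE WITH THE NEXT LEVEL: the coarse pair of the rooted-gauge-fixed pair `(U₀, U₁^g)` is the
coarse pair `(scaled L U₀, scaled L U₁)` with the second member IN THE GAUGE `h`:  `scaled L (U₁^g) = (scaled L U₁)^h`
(the block-wise comb factor is `1` at corners; CONTEXT: (65)/(68) «Ũ′^{j+1}_c = (\overline{Ũ′^jŪ₀^j})_c(\overline{Ū₀^j})_c⁻¹»). -/
theorem scaled_gaugeAct_rooted {L : ℕ} (hL : 1 ≤ L) (h : Site d → Rˣ) (U₀ U₁ : Cfg d R) :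
    scaled L (gaugeAct (rooted L h U₀ U₁) U₁) = gaugeAct h (scaled L U₁) := by
  rw [gaugeAct_rooted, scaled_gaugeAct, scaled_gaugeAct_liftGauge hL]
  funext y' ν
  simp only [gaugeAct]
  rw [blockComb_of_inBlock hL U₀ _ (isCorner_cornerOf L y') (inBlock_self hL _), combGauge_corner,
    blockComb_of_inBlock hL U₀ _ (isCorner_cornerOf L (y' + e ν)) (inBlock_self hL _), combGauge_corner]
  simp

/-- [folklore] (e) **THE ROOTED LATTICE BOUND**: for a unitary-like pair `(U₀, U₁)` on `ℤ^d` with global curvature sups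
`q₁, q₀`, and ANY unitary-like root values `h`, the rooted gauge `g` gives on EVERY bond `b` of `ℤ^d`
`‖(U₁^g)(b)·U₀(b)⁻¹ − 1‖ ≤ crossConst d L·(q₁ + q₀) + X`, where `X` bounds the relative deviation of the COARSE pair
`(scaled L U₀, (scaled L U₁)^h)` IN THE GAUGE `h` — the free number of `lattice_bound_coarse`, handed to the next level. -/
theorem lattice_bound_rooted [NormOneClass R] {U₀ U₁ : Cfg d R} {h : Site d → Rˣ} {L : ℕ} {q₁ q₀ X : ℝ}
    (hU₀ : ∀ x ν, UnitaryLike (U₀ x ν)) (hU₁ : ∀ x ν, UnitaryLike (U₁ x ν)) (hh : ∀ y', UnitaryLike (h y'))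
    (hL : 1 ≤ L) (hq₁ : ∀ x ρ κ, ρ ≠ κ → ‖(plaq U₁ x ρ κ : R) - 1‖ ≤ q₁)
    (hq₀ : ∀ x ρ κ, ρ ≠ κ → ‖(plaq U₀ x ρ κ : R) - 1‖ ≤ q₀) (hq : 0 ≤ q₁ + q₀)
    (hX : ∀ y' ν, ‖(pert (scaled L U₀) (gaugeAct h (scaled L U₁)) y' ν : R) - 1‖ ≤ X) (x : Site d) (ν : Fin d) :
    ‖(pert U₀ (gaugeAct (rooted L h U₀ U₁) U₁) x ν : R) - 1‖ ≤ crossConst d L * (q₁ + q₀) + X := by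
  have hH := unitaryLike_liftGauge hh L
  rw [gaugeAct_rooted]
  refine lattice_bound_coarse hU₀ (unitaryLike_gaugeAct hH hU₁) hL (plaq_bound_gaugeAct hH hq₁) hq₀ hq ?_ x ν
  intro y μ hy
  obtain ⟨y', rfl⟩ : ∃ y', y = cornerOf L y' := ⟨_, (cornerOf_blockIndex hy).symm⟩
  have e2 : pert (coarse L U₀) (coarse L (gaugeAct (liftGauge L h) U₁)) (cornerOf L y') μ =
      pert (scaled L U₀) (gaugeAct h (scaled L U₁)) y' μ := by
    rw [← scaled_gaugeAct_liftGauge hL h U₁]; rfl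
  rw [e2]
  exact hX y' μ

/-! ## §4  Scale composition: straight transports concatenate, `scaled L' ∘ scaled L = scaled (L·L')` -/

/-- [folklore] CONCATENATION of straight transports: `U(Γ_{y,y+(a+b)e_ν}) = U(Γ_{y,y+ae_ν})·U(Γ_{y+ae_ν,y+(a+b)e_ν})`. -/
theorem hol_line_append (U : Cfg d R) (y : Site d) (ν : Fin d) (a : ℕ) :
    ∀ b : ℕ, hol U y (Pi.single ν (a + b)) = hol U y (Pi.single ν a) * hol U (site y (Pi.single ν a)) (Pi.single ν b)
  | 0 => by simp [hol_zero]
  | b + 1 => by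
      rw [← add_assoc, hol_line_succ, hol_line_append U y ν a b, hol_line_succ, site_site, ← Pi.single_add, mul_assoc]

/-- [folklore] A straight segment of the COARSE configuration is a straight segment of the fine one:
`(scaled L U)(Γ_{y',y'+ne_ν}) = U(Γ_{Ly', Ly'+(Ln)e_ν})`. -/
theorem hol_scaled_line (L : ℕ) (U : Cfg d R) (y' : Site d) (ν : Fin d) :
    ∀ n : ℕ, hol (scaled L U) y' (Pi.single ν n) = hol U (cornerOf L y') (Pi.single ν (L * n))
  | 0 => by simp [hol_zero]
  | n + 1 => by
      rw [hol_line_succ, hol_scaled_line L U y' ν n, Nat.mul_succ, hol_line_append]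
      congr 1
      show hol U (cornerOf L (site y' (Pi.single ν n))) (Pi.single ν L) = _
      rw [site_cornerOf_single]

/-- [folklore] **SCALE COMPOSITION**: coarse-graining by `L` then by `L'` is coarse-graining by `L·L'`. -/
theorem scaled_scaled (L L' : ℕ) (U : Cfg d R) : scaled L' (scaled L U) = scaled (L * L') U := by
  funext y ν
  show hol (scaled L U) (cornerOf L' y) (Pi.single ν L') = hol U (cornerOf (L * L') y) (Pi.single ν (L * L'))
  rw [hol_scaled_line, cornerOf_cornerOf]

/-- [folklore] Scale `1` is the identity. -/
theorem scaled_one (U : Cfg d R) : scaled 1 U = U := by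
  funext y ν
  show hol U (cornerOf 1 y) (Pi.single ν 1) = U y ν
  have h1 : cornerOf 1 y = y := by funext i; simp [cornerOf]
  have h2 : (Pi.single ν 1 : Fin d → ℕ) = 0 + Pi.single ν 1 := (zero_add _).symm
  rw [h1, h2, hol_succ U y (isTree_zero ν), hol_zero, one_mul, site_zero]

/-! ## §5  Two levels: the root values chosen as the block-wise comb gauge of the coarse pair -/

/-- [folklore] **THE TWO-LEVEL BOUND**: block-wise relative comb gauge at scale `L`, rooted in the block-wise relative comb
gauge of the coarse pair at scale `L'`: every bond of `ℤ^d` has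
`‖(U₁^g)(b)·U₀(b)⁻¹ − 1‖ ≤ crossConst d L·(q₁ + q₀) + (crossConst d L'·(Q₁ + Q₀) + X)`, `Qᵢ` the curvature sups of the coarse
configurations `scaled L Uᵢ`, `X` the relative deviation of the pair `scaled (L·L') Uᵢ` two levels up (CONTEXT: (64)–(66)). -/
theorem two_level_bound [NormOneClass R] {U₀ U₁ : Cfg d R} {L L' : ℕ} {q₁ q₀ Q₁ Q₀ X : ℝ}
    (hU₀ : ∀ x ν, UnitaryLike (U₀ x ν)) (hU₁ : ∀ x ν, UnitaryLike (U₁ x ν)) (hL : 1 ≤ L) (hL' : 1 ≤ L')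
    (hq₁ : ∀ x ρ κ, ρ ≠ κ → ‖(plaq U₁ x ρ κ : R) - 1‖ ≤ q₁)
    (hq₀ : ∀ x ρ κ, ρ ≠ κ → ‖(plaq U₀ x ρ κ : R) - 1‖ ≤ q₀) (hq : 0 ≤ q₁ + q₀)
    (hQ₁ : ∀ x ρ κ, ρ ≠ κ → ‖(plaq (scaled L U₁) x ρ κ : R) - 1‖ ≤ Q₁)
    (hQ₀ : ∀ x ρ κ, ρ ≠ κ → ‖(plaq (scaled L U₀) x ρ κ : R) - 1‖ ≤ Q₀) (hQ : 0 ≤ Q₁ + Q₀)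
    (hX : ∀ z ν, ‖(pert (scaled (L * L') U₀) (scaled (L * L') U₁) z ν : R) - 1‖ ≤ X) (x : Site d) (ν : Fin d) :
    ‖(pert U₀ (gaugeAct (rooted L (blockComb L' (scaled L U₀) (scaled L U₁)) U₀ U₁) U₁) x ν : R) - 1‖ ≤
      crossConst d L * (q₁ + q₀) + (crossConst d L' * (Q₁ + Q₀) + X) := by
  have hV₀ := unitaryLike_scaled hU₀ L
  have hV₁ := unitaryLike_scaled hU₁ L
  refine lattice_bound_rooted hU₀ hU₁ (unitaryLike_blockComb hV₀ hV₁ L') hL hq₁ hq₀ hq ?_ x ν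
  intro y' μ
  refine lattice_bound_coarse hV₀ hV₁ hL' hQ₁ hQ₀ hQ ?_ y' μ
  intro z κ hz
  obtain ⟨z', rfl⟩ : ∃ z', z = cornerOf L' z' := ⟨_, (cornerOf_blockIndex hz).symm⟩
  have e2 : pert (coarse L' (scaled L U₀)) (coarse L' (scaled L U₁)) (cornerOf L' z') κ =
      pert (scaled (L * L') U₀) (scaled (L * L') U₁) z' κ := by
    rw [← scaled_scaled L L' U₀, ← scaled_scaled L L' U₁]; rfl
  rw [e2]
  exact hX z' κ

/-! ## §6  k levels: the recursive rooted gauge along a list of scales, and the multilevel bound -/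

/-- [folklore] THE MULTILEVEL RELATIVE COMB GAUGE for the scales `[L₁, L₂, …, L_k]` (finest first) and a TOP gauge `hTop`
on the coarsest lattice: no scales — the top gauge itself; otherwise the rooted gauge at scale `L₁` whose root values are
the multilevel gauge of the coarse pair `(scaled L₁ U₀, scaled L₁ U₁)` for the remaining scales (CONTEXT: (64)–(68),
(73)–(77)). -/
noncomputable def multiComb : List ℕ → (Site d → Rˣ) → Cfg d R → Cfg d R → (Site d → Rˣ)
  | [], hTop, _, _ => hTop
  | L :: Ls, hTop, U₀, U₁ => rooted L (multiComb Ls hTop (scaled L U₀) (scaled L U₁)) U₀ U₁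

/-- [folklore] THE ACCUMULATED CONSTANT `Σ_j crossConst d L_j·c_j` along the list of scales. -/
def scaleSum (d : ℕ) : List ℕ → (ℕ → ℝ) → ℝ
  | [], _ => 0
  | L :: Ls, c => crossConst d L * c 0 + scaleSum d Ls (fun j => c (j + 1))

/-- [folklore] Unfolding, no scales. -/
theorem multiComb_nil (hTop : Site d → Rˣ) (U₀ U₁ : Cfg d R) : multiComb [] hTop U₀ U₁ = hTop := rfl

/-- [folklore] Unfolding, one more scale. -/
theorem multiComb_cons (L : ℕ) (Ls : List ℕ) (hTop : Site d → Rˣ) (U₀ U₁ : Cfg d R) :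
    multiComb (L :: Ls) hTop U₀ U₁ = rooted L (multiComb Ls hTop (scaled L U₀) (scaled L U₁)) U₀ U₁ := rfl

/-- [folklore] The multilevel gauge is unitary-like for unitary-like data. -/
theorem unitaryLike_multiComb [NormOneClass R] (Ls : List ℕ) :
    ∀ {hTop : Site d → Rˣ} {U₀ U₁ : Cfg d R}, (∀ x ν, UnitaryLike (U₀ x ν)) → (∀ x ν, UnitaryLike (U₁ x ν)) →
      (∀ x, UnitaryLike (hTop x)) → ∀ x, UnitaryLike (multiComb Ls hTop U₀ U₁ x) := by
  induction Ls with
  | nil => intro hTop U₀ U₁ _ _ hh x; exact hh x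
  | cons L Ls ih =>
      intro hTop U₀ U₁ hU₀ hU₁ hh x
      exact unitaryLike_rooted hU₀ hU₁ (ih (unitaryLike_scaled hU₀ L) (unitaryLike_scaled hU₁ L) hh) L x

/-- [folklore] RELATIVE AXIAL GAUGE IN EVERY FINEST BLOCK (CONTEXT: (64)). -/
theorem treeRel_multiComb {L : ℕ} (hL : 1 ≤ L) (Ls : List ℕ) (hTop : Site d → Rˣ) (U₀ U₁ : Cfg d R) {y : Site d}
    (hy : IsCorner L y) : TreeRel L y U₀ (gaugeAct (multiComb (L :: Ls) hTop U₀ U₁) U₁) :=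
  treeRel_rooted hL hy _ U₀ U₁

/-- [folklore] NESTING OF ROOT VALUES: on the corners `L·y'` the multilevel gauge IS the multilevel gauge of the coarse pair
(CONTEXT: (73)/(74)). -/
theorem multiComb_cons_cornerOf {L : ℕ} (hL : 1 ≤ L) (Ls : List ℕ) (hTop : Site d → Rˣ) (U₀ U₁ : Cfg d R)
    (y' : Site d) :
    multiComb (L :: Ls) hTop U₀ U₁ (cornerOf L y') = multiComb Ls hTop (scaled L U₀) (scaled L U₁) y' :=
  rooted_cornerOf hL _ U₀ U₁ y'

/-- [folklore] COHERENCE: the coarse pair of the multilevel-gauge-fixed pair is the coarse pair gauge-fixed by the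
multilevel gauge of the remaining scales (CONTEXT: (65)–(68)), so (64)-type tree conditions hold at EVERY level. -/
theorem scaled_gaugeAct_multiComb {L : ℕ} (hL : 1 ≤ L) (Ls : List ℕ) (hTop : Site d → Rˣ) (U₀ U₁ : Cfg d R) :
    scaled L (gaugeAct (multiComb (L :: Ls) hTop U₀ U₁) U₁) =
      gaugeAct (multiComb Ls hTop (scaled L U₀) (scaled L U₁)) (scaled L U₁) :=
  scaled_gaugeAct_rooted hL _ U₀ U₁

/-- [folklore] THE TOP GAUGE IS FREE: at the corners of the coarsest lattice, `L₁⋯L_k·z`, the multilevel gauge takes the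
prescribed top values `hTop(z)` (CONTEXT: p. 30 — print fixes them by (81); here they stay free). -/
theorem multiComb_top (Ls : List ℕ) :
    ∀ {hTop : Site d → Rˣ} {U₀ U₁ : Cfg d R}, (∀ L ∈ Ls, 1 ≤ L) →
      ∀ z, multiComb Ls hTop U₀ U₁ (cornerOf Ls.prod z) = hTop z := by
  induction Ls with
  | nil =>
      intro hTop U₀ U₁ _ z
      have h1 : cornerOf (List.prod ([] : List ℕ)) z = z := by funext i; simp [cornerOf]
      rw [h1]; rfl
  | cons L Ls ih =>
      intro hTop U₀ U₁ hLs z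
      have hL : 1 ≤ L := hLs L (List.mem_cons.2 (Or.inl rfl))
      have hLs' : ∀ L' ∈ Ls, 1 ≤ L' := fun L' h => hLs L' (List.mem_cons.2 (Or.inr h))
      rw [List.prod_cons, ← cornerOf_cornerOf, multiComb_cons_cornerOf hL]
      exact ih hLs' z

/-- [folklore] **THE MULTILEVEL BOUND**: for a unitary-like pair `(U₀, U₁)` on `ℤ^d`, scales `L₁, …, L_k ≥ 1`, per-level
curvature sups `qᵢ⁽ʲ⁾` of the level-`j` coarse configurations `scaled (L₁⋯L_j) Uᵢ` (`j = 0, …, k−1`; FREE hypotheses, cf.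
§7), a unitary-like top gauge `hTop`, and `X` bounding the relative deviation of the top pair `(scaled (L₁⋯L_k) U₀,
(scaled (L₁⋯L_k) U₁)^{hTop})`: the multilevel gauge `g` gives on EVERY bond `b` of `ℤ^d`
`‖(U₁^g)(b)·U₀(b)⁻¹ − 1‖ ≤ Σ_j crossConst d L_{j+1}·(q₁⁽ʲ⁾ + q₀⁽ʲ⁾) + X` (induction on the list: `lattice_bound_rooted` at the
finest scale, the induction hypothesis for the coarse pair as its free number, `scaled_scaled` to re-index levels). -/
theorem multilevel_bound [NormOneClass R] (Ls : List ℕ) :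
    ∀ {U₀ U₁ : Cfg d R} {hTop : Site d → Rˣ} {q₁ q₀ : ℕ → ℝ} {X : ℝ},
      (∀ x ν, UnitaryLike (U₀ x ν)) → (∀ x ν, UnitaryLike (U₁ x ν)) → (∀ x, UnitaryLike (hTop x)) →
      (∀ L ∈ Ls, 1 ≤ L) →
      (∀ j, j < Ls.length → ∀ x ρ κ, ρ ≠ κ → ‖(plaq (scaled (Ls.take j).prod U₁) x ρ κ : R) - 1‖ ≤ q₁ j) →
      (∀ j, j < Ls.length → ∀ x ρ κ, ρ ≠ κ → ‖(plaq (scaled (Ls.take j).prod U₀) x ρ κ : R) - 1‖ ≤ q₀ j) →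
      (∀ j, j < Ls.length → 0 ≤ q₁ j + q₀ j) →
      (∀ z ν, ‖(pert (scaled Ls.prod U₀) (gaugeAct hTop (scaled Ls.prod U₁)) z ν : R) - 1‖ ≤ X) →
      ∀ x ν, ‖(pert U₀ (gaugeAct (multiComb Ls hTop U₀ U₁) U₁) x ν : R) - 1‖ ≤
        scaleSum d Ls (fun j => q₁ j + q₀ j) + X := by
  induction Ls with
  | nil =>
      intro U₀ U₁ hTop q₁ q₀ X _ _ _ _ _ _ _ hX x ν
      have h := hX x ν
      rw [List.prod_nil, scaled_one, scaled_one] at h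
      simpa [multiComb, scaleSum] using h
  | cons L Ls ih =>
      intro U₀ U₁ hTop q₁ q₀ X hU₀ hU₁ hh hLs hq₁ hq₀ hq hX x ν
      have hL : 1 ≤ L := hLs L (List.mem_cons.2 (Or.inl rfl))
      have hLs' : ∀ L' ∈ Ls, 1 ≤ L' := fun L' h => hLs L' (List.mem_cons.2 (Or.inr h))
      have hlen : ∀ j, j < Ls.length → j + 1 < (L :: Ls).length := fun j hj => by
        simp only [List.length_cons]; omega
      have h0 : 0 < (L :: Ls).length := by simp
      -- level 0 = the pair itself
      have hq₁0 : ∀ x ρ κ, ρ ≠ κ → ‖(plaq U₁ x ρ κ : R) - 1‖ ≤ q₁ 0 := by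
        have h := hq₁ 0 h0
        simp only [List.take_zero, List.prod_nil, scaled_one] at h
        exact h
      have hq₀0 : ∀ x ρ κ, ρ ≠ κ → ‖(plaq U₀ x ρ κ : R) - 1‖ ≤ q₀ 0 := by
        have h := hq₀ 0 h0
        simp only [List.take_zero, List.prod_nil, scaled_one] at h
        exact h
      -- levels ≥ 1 = the levels of the coarse pair
      have hV₀ := unitaryLike_scaled hU₀ L
      have hV₁ := unitaryLike_scaled hU₁ L
      have hq₁' : ∀ j, j < Ls.length → ∀ x ρ κ, ρ ≠ κ →
          ‖(plaq (scaled (Ls.take j).prod (scaled L U₁)) x ρ κ : R) - 1‖ ≤ q₁ (j + 1) := by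
        intro j hj x ρ κ hρκ
        have h := hq₁ (j + 1) (hlen j hj) x ρ κ hρκ
        simp only [List.take_succ_cons, List.prod_cons] at h
        rwa [← scaled_scaled] at h
      have hq₀' : ∀ j, j < Ls.length → ∀ x ρ κ, ρ ≠ κ →
          ‖(plaq (scaled (Ls.take j).prod (scaled L U₀)) x ρ κ : R) - 1‖ ≤ q₀ (j + 1) := by
        intro j hj x ρ κ hρκ
        have h := hq₀ (j + 1) (hlen j hj) x ρ κ hρκ
        simp only [List.take_succ_cons, List.prod_cons] at h
        rwa [← scaled_scaled] at h
      have hq' : ∀ j, j < Ls.length → 0 ≤ q₁ (j + 1) + q₀ (j + 1) := fun j hj => hq (j + 1) (hlen j hj)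
      have hX' : ∀ z ν, ‖(pert (scaled Ls.prod (scaled L U₀)) (gaugeAct hTop (scaled Ls.prod (scaled L U₁))) z ν : R)
          - 1‖ ≤ X := by
        intro z ν
        have h := hX z ν
        simp only [List.prod_cons] at h
        rwa [← scaled_scaled, ← scaled_scaled] at h
      have ih' := ih hV₀ hV₁ hh hLs' hq₁' hq₀' hq' hX'
      show _ ≤ crossConst d L * (q₁ 0 + q₀ 0) + scaleSum d Ls (fun j => q₁ (j + 1) + q₀ (j + 1)) + X
      rw [add_assoc, multiComb_cons]
      exact lattice_bound_rooted hU₀ hU₁ (unitaryLike_multiComb Ls hV₀ hV₁ hh) hL hq₁0 hq₀0 (hq 0 h0) ih' x ν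

/-! ## §7  The coarse curvatures discharged: `scaled = T4BlockTransport.blockCfg` and non-abelian Stokes BY NAME -/

/-- [folklore] A straight segment all of whose bonds carry `1` has transport `1`. -/
theorem hol_line_eq_one {V : Cfg d R} {y : Site d} {ν : Fin d} :
    ∀ n : ℕ, (∀ j, j < n → V (site y (Pi.single ν j)) ν = 1) → hol V y (Pi.single ν n) = 1
  | 0, _ => by simp [hol_zero]
  | n + 1, h => by
      rw [hol_line_succ, hol_line_eq_one n (fun j hj => h j (by omega)), h n (by omega), one_mul]

/-- [folklore] DICTIONARY (sites): `z + n·e_μ` in `T4BlockTransport`'s `zsmul` notation is `site z (n e_μ)`. -/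
theorem site_single_eq (x : Site d) (μ : Fin d) (n : ℕ) : site x (Pi.single μ n) = x + (n : ℤ) • e μ := by
  funext κ
  by_cases h : κ = μ
  · subst h; simp [site, e]
  · simp [site, e, h]

/-- [folklore] DICTIONARY (segments): `T4BlockTransport.segHol U x μ n` IS the straight transport `hol U x (n e_μ)`. -/
theorem segHol_eq_hol (U : Cfg d R) (x : Site d) (μ : Fin d) : ∀ n : ℕ, segHol U x μ n = hol U x (Pi.single μ n)
  | 0 => by simp [hol_zero]
  | n + 1 => by rw [segHol_succ, hol_line_succ, segHol_eq_hol U x μ n, site_single_eq]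

/-- [folklore] DICTIONARY (corners): `L·y' = L • y'`. -/
theorem cornerOf_eq_nsmul (L : ℕ) (y' : Site d) : cornerOf L y' = L • y' := by
  funext i; simp [cornerOf]

/-- [folklore] DICTIONARY (coarse configurations): `T4BlockTransport.blockCfg L U` (blocking factor `L`, straight-segment
variables) IS `scaled L U`. -/
theorem blockCfg_eq_scaled (L : ℕ) (U : Cfg d R) : blockCfg L U = scaled L U := by
  funext y' ν
  show segHol U (L • y') ν L = hol U (cornerOf L y') (Pi.single ν L)
  rw [segHol_eq_hol, cornerOf_eq_nsmul]

/-- [folklore] **THE COARSE CURVATURE BOUND** `‖plaq (scaled L U) − 1‖ ≤ L²·q` for a unitary-like configuration with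
global curvature sup `q`: `T4BlockTransport.norm_plaq_blockCfg_sub_one_le'` (non-abelian Stokes on the `L × L`
rectangle, BY NAME) through the dictionary `blockCfg_eq_scaled`.  Hence the level-`j` hypotheses of `multilevel_bound`
hold with `qᵢ⁽ʲ⁾ = (L₁⋯L_j)²·qᵢ` (CONTEXT: p. 26 «Each averaging operation rescales a bound on plaquette variables
approximately by the factor L², hence k operations by the factor L^{2k}.», printed for the averages, (51)). -/
theorem norm_plaq_scaled_sub_one_le [NormOneClass R] {U : Cfg d R} (hU : ∀ x ν, UnitaryLike (U x ν)) {L : ℕ} {q : ℝ}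
    (hq : ∀ x ρ κ, ρ ≠ κ → ‖(plaq U x ρ κ : R) - 1‖ ≤ q) (z : Site d) (ρ κ : Fin d) (hρκ : ρ ≠ κ) :
    ‖(plaq (scaled L U) z ρ κ : R) - 1‖ ≤ (L : ℝ) ^ 2 * q := by
  have hq0 : 0 ≤ q := (norm_nonneg _).trans (hq z ρ κ hρκ)
  rw [← blockCfg_eq_scaled]
  exact norm_plaq_blockCfg_sub_one_le' hU L hq0 (fun x => hq x ρ κ hρκ) z

/-- [folklore] **THE MULTILEVEL BOUND WITH THE CURVATURE HYPOTHESES DISCHARGED**: with only the GLOBAL curvature sups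
`q₁, q₀` of the pair (and the free top data `hTop`, `X`), on EVERY bond of `ℤ^d`
`‖(U₁^g)(b)·U₀(b)⁻¹ − 1‖ ≤ Σ_j crossConst d L_{j+1}·(L₁⋯L_j)²·(q₁ + q₀) + X` (`multilevel_bound` fed by
`norm_plaq_scaled_sub_one_le` at every level). -/
theorem multilevel_bound_global [NormOneClass R] (Ls : List ℕ) {U₀ U₁ : Cfg d R} {hTop : Site d → Rˣ}
    {q₁ q₀ X : ℝ} (hU₀ : ∀ x ν, UnitaryLike (U₀ x ν)) (hU₁ : ∀ x ν, UnitaryLike (U₁ x ν))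
    (hh : ∀ x, UnitaryLike (hTop x)) (hLs : ∀ L ∈ Ls, 1 ≤ L)
    (hq₁ : ∀ x ρ κ, ρ ≠ κ → ‖(plaq U₁ x ρ κ : R) - 1‖ ≤ q₁)
    (hq₀ : ∀ x ρ κ, ρ ≠ κ → ‖(plaq U₀ x ρ κ : R) - 1‖ ≤ q₀) (hq : 0 ≤ q₁ + q₀)
    (hX : ∀ z ν, ‖(pert (scaled Ls.prod U₀) (gaugeAct hTop (scaled Ls.prod U₁)) z ν : R) - 1‖ ≤ X)
    (x : Site d) (ν : Fin d) :
    ‖(pert U₀ (gaugeAct (multiComb Ls hTop U₀ U₁) U₁) x ν : R) - 1‖ ≤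
      scaleSum d Ls (fun j => (((Ls.take j).prod : ℕ) : ℝ) ^ 2 * (q₁ + q₀)) + X := by
  have hf : (fun j => (((Ls.take j).prod : ℕ) : ℝ) ^ 2 * (q₁ + q₀)) =
      fun j => (((Ls.take j).prod : ℕ) : ℝ) ^ 2 * q₁ + (((Ls.take j).prod : ℕ) : ℝ) ^ 2 * q₀ := by
    funext j; ring
  rw [hf]
  refine multilevel_bound Ls (q₁ := fun j => (((Ls.take j).prod : ℕ) : ℝ) ^ 2 * q₁)
    (q₀ := fun j => (((Ls.take j).prod : ℕ) : ℝ) ^ 2 * q₀) hU₀ hU₁ hh hLs ?_ ?_ ?_ hX x ν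
  · intro j _ y ρ κ hρκ; exact norm_plaq_scaled_sub_one_le hU₁ hq₁ y ρ κ hρκ
  · intro j _ y ρ κ hρκ; exact norm_plaq_scaled_sub_one_le hU₀ hq₀ y ρ κ hρκ
  · intro j _
    have h := mul_nonneg (sq_nonneg (((Ls.take j).prod : ℕ) : ℝ)) hq
    nlinarith [h]

/-! ## §8  Non-vacuity / sanity -/

/-- One scale: the multilevel gauge is the rooted gauge with the top values as roots. -/
example (L : ℕ) (hTop : Site d → Rˣ) (U₀ U₁ : Cfg d R) :
    multiComb [L] hTop U₀ U₁ = rooted L hTop U₀ U₁ := by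
  rw [multiComb_cons, multiComb_nil]

/-- Two scales: the accumulated constant. -/
example (d : ℕ) (c : ℕ → ℝ) : scaleSum d [2, 3] c = crossConst d 2 * c 0 + (crossConst d 3 * c 1 + 0) := by
  simp [scaleSum]

/-- The rooted gauge with root values `1` is the block-wise comb gauge of `T4BlockwiseCombGauge`. -/
example {L : ℕ} (U₀ U₁ : Cfg d R) : rooted L (fun _ => 1) U₀ U₁ = blockComb L U₀ U₁ := by
  funext x
  have hlift : (liftGauge L (fun _ => (1 : Rˣ)) : Site d → Rˣ) = fun _ => 1 := rfl
  have hact : gaugeAct (fun _ => (1 : Rˣ)) U₁ = U₁ := by funext x ν; simp [gaugeAct]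
  simp only [rooted, hlift, hact, mul_one]

/-- Non-vacuity of the multilevel bound's hypotheses: the flat pair `U₀ = U₁ = 1` with top gauge `1` satisfies them with
all `q = 0`, `X = 0` (every straight transport of `1` is `1`), and the conclusion is then the true statement `0 ≤ 0`. -/
example [NormOneClass R] (Ls : List ℕ) (hLs : ∀ L ∈ Ls, 1 ≤ L) (x : Site d) (ν : Fin d) :
    ‖(pert (fun _ _ => (1 : Rˣ)) (gaugeAct (multiComb Ls (fun _ => 1) (fun _ _ => 1) (fun _ _ => 1))
      (fun _ _ => (1 : Rˣ))) x ν : R) - 1‖ ≤ scaleSum d Ls (fun _ => 0 + 0) + 0 := by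
  have h1 : ∀ (x : Site d) (ν : Fin d), UnitaryLike ((fun _ _ => (1 : Rˣ)) x ν) := fun _ _ => UnitaryLike.one
  have hflat : ∀ M : ℕ, scaled M (fun _ _ => (1 : Rˣ)) = (fun _ _ => (1 : Rˣ) : Cfg d R) := by
    intro M; funext y μ
    exact hol_line_eq_one M (fun _ _ => rfl)
  refine multilevel_bound Ls h1 h1 (fun _ => UnitaryLike.one) hLs ?_ ?_ (fun _ _ => by norm_num) ?_ x ν
  · intro j _ x ρ κ _; rw [hflat]; simp [plaq]
  · intro j _ x ρ κ _; rw [hflat]; simp [plaq]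
  · intro z μ; rw [hflat]; simp [pert, gaugeAct]

end Literature.MathematicalPhysics.QuantumFieldTheory.Balaban1983to89.T4MultilevelCombGauge
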